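import Mathlib
import HarnessLib
import Summits.AtomisticToContinuum.Crystallization.Theorems.FrustratedLawDichotomyTwoShellRigidityLsFitReplaySound2
import Summits.AtomisticToContinuum.Crystallization.Theorems.FrustratedLawDichotomyTwoShellRigidityLsLedgerArrow

/-!
# Two-shell rigidity, slot 3 · the `SphericalLsFit` replay engine (4a): labelled fields, probes and the
# integer-functional dictionary   (decomp-a2c, lens 3, gen 37 — NODE «SphericalLsFitReplay»)

Sequel of `…LsFitReplaySound2`.  From the certified `LeafBounds` of a configuration `p : Fin 12 → ℝ³`
(frame coordinates `X`, leaf frame `R = M/n` from the quaternion) to the four REAL conclusions of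
`SphericalLsFit` for the labelled dozen: with the isometry `A := (colBasis R)⁻¹ ∘ (frameBasis)⁻¹`
(pattern frame → leaf frame → configuration frame) and the labelled residual `r i = A⁻¹ (p i) − uᵢ`
(`uᵢ = patPt m i = tab i/√N`):
(F0) `‖r i‖ ≤ α`; (F1) `‖lsRotL r‖ ≤ Ω` (`lsRotL r = (1/8) Σ uᵢ × rᵢ`); (F2) `⟪m/√k, rᵢ − lsRotL r × uᵢ⟫ ≤ V₁`
for every probe of the table; (F3) the same for differences over bonded pairs, `≤ V₃` — the theorem `fit_geometry`
itself is part (4b) `…LsFitReplayGeom` (mechanical split for the 400-line rule); this part holds the labelled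
fields `probeVec`/`lsRotL`/`derotL` and the dictionary lemmas (`fval_*`, `probe_row_bound`).
The dictionary (all identities are coordinate computations in the pattern frame):
`⟪p i, A uᵢ⟫ = F0ᵢ(X)/(n√N)`, `(lsRotL r)_c = W_c(X)/(8 n √N)`,
`⟪m, rᵢ − lsRotL r × uᵢ⟫ = Gᵢ(X)/(8 n N) − ⟪m, tab i⟫/√N` with `F0ᵢ, W_c, Gᵢ` the integer functionals
`fitObj0, fitObjW, fitObj2` of part 1 evaluated at `X` (`fval`).
`[folklore]`; no `sorry`; no `instance`/`notation`; no data.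
-/

namespace Summit.AtomisticToContinuum.Crystallization.Theorems

namespace Rig

open Literature.Geometry.DiscreteGeometry
open Literature.Analysis.ValidatedNumerics.NumericsMP
open Summit.AtomisticToContinuum.Crystallization.Theorems.FrustratedLawDichotomyTwoShellRigidityLsLedger
open Summit.AtomisticToContinuum.Crystallization.Theorems.FrustratedLawDichotomyTwoShellRigidityCut (E3)
open Summit.AtomisticToContinuum.Crystallization.Theorems.FrustratedLawDichotomyTwoShellRigidityGaugedLadder
open scoped RealInnerProductSpace

/-! ### Labelled residual fields and probes -/

/-- The probe vector `m/√k` of a probe-table entry `(m, k)`. -/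
noncomputable def probeVec (e : (Fin 3 → ℤ) × ℕ) : E3 := (Real.sqrt e.2)⁻¹ • intVec e.1

/-- The least-squares rotation of a LABELLED residual field: `(1/8) Σ_i uᵢ × rᵢ` (`= lsRot` after
reindexing the pattern by labels). -/
noncomputable def lsRotL (m : Model) (r : Fin 12 → E3) : E3 := (1 / 8 : ℝ) • ∑ i, cross (patPt m i) (r i)

/-- The de-rotated labelled residual `rᵢ − (lsRotL r) × uᵢ` (`= derot` after reindexing). -/
noncomputable def derotL (m : Model) (r : Fin 12 → E3) (i : Fin 12) : E3 :=
  r i - cross (lsRotL m r) (patPt m i)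

/-! ### Small lemmas -/

/-- Coordinates of `(colBasis R).repr v`: `(Rᵀ v)_l`. -/
theorem colBasis_repr_apply (R : Fin 3 → Fin 3 → ℝ)
    (hR : ∀ i j, (∑ k, R k i * R k j) = if i = j then 1 else 0) (v : E3) (l : Fin 3) :
    ((colBasis R hR).repr v) l = ∑ k, R k l * v k := by
  rw [OrthonormalBasis.repr_apply_apply, colBasis_apply, inner_fin3]
  simp [Fin.sum_univ_three]

/-- Coordinates of a pattern point (application form of `patPt_apply`). -/
theorem patPt_apply' (m : Model) (i : Fin 12) (l : Fin 3) :
    (patPt m i) l = (m.tab i l : ℝ) / Real.sqrt m.normSq := patPt_apply m i l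

/-- `encBelow N c · √N ≤ S · c`. -/
theorem encBelow_mul_sqrt_le {N : ℕ} (hN : 0 < N) (c : ℤ) :
    (encBelow N c : ℝ) * Real.sqrt N ≤ (SC : ℝ) * c := by
  unfold encBelow
  split_ifs with hc
  · push_cast
    have h := invSqrtLo_le hN
    have hc' : (0 : ℝ) ≤ c := by exact_mod_cast hc
    nlinarith
  · push_cast
    have h := le_invSqrtHi hN
    have hc' : (c : ℝ) ≤ 0 := by exact_mod_cast (not_le.1 hc).le
    nlinarith

/-- `fval` is additive (subtraction). -/
theorem fval_sub (g h : Fin 12 → Fin 3 → ℤ) (x : Fin 12 → Fin 3 → ℝ) :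
    fval (fun v b => g v b - h v b) x = fval g x - fval h x := by
  unfold fval
  rw [← Finset.sum_sub_distrib]
  refine Finset.sum_congr rfl fun v _ => ?_
  rw [← Finset.sum_sub_distrib]
  refine Finset.sum_congr rfl fun b _ => ?_
  push_cast; ring

/-- `fval` of an integer combination of fields. -/
theorem fval_comb (c : Fin 3 → ℤ) (G : Fin 3 → Fin 12 → Fin 3 → ℤ) (x : Fin 12 → Fin 3 → ℝ) :
    fval (fun v b => ∑ k, c k * G k v b) x = ∑ k, (c k : ℝ) * fval (G k) x := by
  unfold fval
  calc (∑ v, ∑ b, ((∑ k, c k * G k v b : ℤ) : ℝ) * x v b)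
      = ∑ v, ∑ b, ∑ k, (c k : ℝ) * ((G k v b : ℝ) * x v b) := by
        refine Finset.sum_congr rfl fun v _ => Finset.sum_congr rfl fun b _ => ?_
        push_cast
        rw [Finset.sum_mul]
        refine Finset.sum_congr rfl fun k _ => ?_
        ring
    _ = ∑ v, ∑ k, ∑ b, (c k : ℝ) * ((G k v b : ℝ) * x v b) := by
        refine Finset.sum_congr rfl fun v _ => ?_
        rw [Finset.sum_comm]
    _ = ∑ k, ∑ v, ∑ b, (c k : ℝ) * ((G k v b : ℝ) * x v b) := by rw [Finset.sum_comm]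
    _ = ∑ k, (c k : ℝ) * ∑ v, ∑ b, (G k v b : ℝ) * x v b := by
        refine Finset.sum_congr rfl fun k _ => ?_
        rw [Finset.mul_sum]
        refine Finset.sum_congr rfl fun v _ => ?_
        rw [Finset.mul_sum]

/-- `fval` of a one-point field. -/
theorem fval_single (i : Fin 12) (c : Fin 3 → ℤ) (x : Fin 12 → Fin 3 → ℝ) :
    fval (fun v b => if v = i then c b else 0) x = ∑ b, (c b : ℝ) * x i b := by
  unfold fval
  rw [Finset.sum_eq_single i]
  · simp
  · intro v _ hv
    simp [hv]
  · intro h; exact absurd (Finset.mem_univ i) h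

/-- `fval (fitObj0 i) x = Σ_b (M tab i)_b · x i b`. -/
theorem fval_fitObj0 (m : Model) (Mq : Fin 3 → Fin 3 → ℤ) (i : Fin 12) (x : Fin 12 → Fin 3 → ℝ) :
    fval (fitObj0 m Mq i) x = ∑ b, (mulVecZ Mq (m.tab i) b : ℝ) * x i b := by
  unfold fitObj0; exact fval_single i _ x

/-- `fval (fitObj2 mv i) x = 8N·Σ_b (M mv)_b · x i b − Σ_c (tab i × mv)_c · W_c(x)`. -/
theorem fval_fitObj2 (m : Model) (Mq : Fin 3 → Fin 3 → ℤ) (mv : Fin 3 → ℤ) (i : Fin 12)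
    (x : Fin 12 → Fin 3 → ℝ) :
    fval (fitObj2 m Mq mv i) x =
      8 * (m.normSq : ℝ) * (∑ b, (mulVecZ Mq mv b : ℝ) * x i b) -
        ∑ c, (crossZ (m.tab i) mv c : ℝ) * fval (fitObjW m Mq c) x := by
  have h : fval (fitObj2 m Mq mv i) x =
      fval (fun v b => (if v = i then 8 * (m.normSq : ℤ) * mulVecZ Mq mv b else 0)) x -
        fval (fun v b => ∑ k, crossZ (m.tab i) mv k * fitObjW m Mq k v b) x := by
    rw [← fval_sub]; rfl
  rw [h, fval_single, fval_comb, Finset.mul_sum]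
  congr 1
  refine Finset.sum_congr rfl fun b _ => ?_
  push_cast; ring

/-- `fval (fitObj3 mv i w) = fval (fitObj2 mv i) − fval (fitObj2 mv w)`. -/
theorem fval_fitObj3 (m : Model) (Mq : Fin 3 → Fin 3 → ℤ) (mv : Fin 3 → ℤ) (i w : Fin 12)
    (x : Fin 12 → Fin 3 → ℝ) :
    fval (fitObj3 m Mq mv i w) x = fval (fitObj2 m Mq mv i) x - fval (fitObj2 m Mq mv w) x := by
  rw [← fval_sub]; rfl

/-- `dotZ` is additive in the second argument (difference form). -/
theorem dotZ_sub (a b c : Fin 3 → ℤ) : dotZ a (fun k => b k - c k) = dotZ a b - dotZ a c := by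
  unfold dotZ
  rw [← Finset.sum_sub_distrib]
  refine Finset.sum_congr rfl fun k _ => ?_
  ring

/-- A supported probe type is `1`, `2` or `3`, hence positive. -/
theorem pos_of_kOK {k : ℕ} (hk : kOK k = true) : 0 < k := by
  unfold kOK at hk
  rw [decide_eq_true_eq] at hk
  omega

/-- first coordinate of the integer cross product. -/
@[simp] theorem crossZ_apply_zero (a b : Fin 3 → ℤ) : crossZ a b 0 = a 1 * b 2 - a 2 * b 1 := rfl
/-- second coordinate of the integer cross product. -/
@[simp] theorem crossZ_apply_one (a b : Fin 3 → ℤ) : crossZ a b 1 = a 2 * b 0 - a 0 * b 2 := rfl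
/-- third coordinate of the integer cross product. -/
@[simp] theorem crossZ_apply_two (a b : Fin 3 → ℤ) : crossZ a b 2 = a 0 * b 1 - a 1 * b 0 := rfl

/-- **The arithmetic of one probe row**: from the certified integer inequality
`S·F − 8 n N·encBelow c ≤ n·L` and the level hypothesis `L ≤ 8 N S √k V` to the real bound
`(F/(8 n N) − c/√N)/√k ≤ V`. -/
theorem probe_row_bound {N : ℕ} (hN : 0 < N) {n : ℤ} (hn : 0 < n) {F sk V : ℝ} (hsk : 0 < sk)
    {L c : ℤ} (hrow : (SC : ℝ) * F - 8 * (n : ℝ) * N * (encBelow N c : ℝ) ≤ (n : ℝ) * L)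
    (hL : (L : ℝ) ≤ 8 * N * SC * sk * V) :
    sk⁻¹ * (F / (8 * n * N) - (c : ℝ) / Real.sqrt N) ≤ V := by
  have hNr : (0 : ℝ) < N := by exact_mod_cast hN
  have hn0 : (0 : ℝ) < n := by exact_mod_cast hn
  have hS0 : (0 : ℝ) < SC := by rw [SC]; norm_num
  set sN := Real.sqrt N with hsN
  have hsN0 : 0 < sN := Real.sqrt_pos.2 hNr
  have henc := encBelow_mul_sqrt_le hN c
  have key : (F / (8 * n * N) - (c : ℝ) / sN) * (8 * n * N * SC * sN) ≤
      (sk * V) * (8 * n * N * SC * sN) := by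
    have e1 : (F / (8 * n * N) - (c : ℝ) / sN) * (8 * n * N * SC * sN) =
        sN * (SC * F) - 8 * n * N * (SC * c) := by
      field_simp
    rw [e1]
    have e2 : 8 * (n : ℝ) * N * ((encBelow N c : ℝ) * sN) ≤ 8 * (n : ℝ) * N * (SC * c) :=
      mul_le_mul_of_nonneg_left henc (by positivity)
    calc sN * (SC * F) - 8 * n * N * (SC * c)
        ≤ sN * (SC * F - 8 * n * N * (encBelow N c : ℝ)) := by nlinarith [e2]
      _ ≤ sN * (n * L) := mul_le_mul_of_nonneg_left hrow hsN0.le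
      _ ≤ sN * (n * (8 * N * SC * sk * V)) :=
          mul_le_mul_of_nonneg_left (mul_le_mul_of_nonneg_left hL hn0.le) hsN0.le
      _ = (sk * V) * (8 * n * N * SC * sN) := by ring
  have hle : F / (8 * n * N) - (c : ℝ) / sN ≤ sk * V := le_of_mul_le_mul_right key (by positivity)
  calc sk⁻¹ * (F / (8 * n * N) - (c : ℝ) / sN) ≤ sk⁻¹ * (sk * V) :=
        mul_le_mul_of_nonneg_left hle (inv_nonneg.2 hsk.le)
    _ = V := by field_simp

end Rig

end Summit.AtomisticToContinuum.Crystallization.Theorems
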